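import Summits.CriticalPhenomena.PercolationContinuityZ3.Theorems.PercNearOneGluingNoHeavyLowerTailAttachedChampion
import Literature.Probability.Percolation.TwoSetExchange
import Literature.Probability.Percolation.KozmaNitzanPreFKG
import HarnessLib

/-!
# `NoHeavyLowerTail` (stmt-CriticalPhenomena-4575) — the OBSERVER EXCHANGE ROW and the attached-champion
# inequality for a single relay (`T_b`), with the `N`-weighted form of XZ

Lead of the crux, 2026-08-18.  Bond percolation `μ = prodBernoulli w` on `Fin n`, relays `A`, level `j`,
`M_x(ω) = |{a ∈ A : x ↔ a}|` (`= (A.filter fun a => ω ∈ openConn x a).card`), an observer `o` (any vertex),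
"light" `= {M ≤ j}`, "heavy" `= {j < M}`.

* `observer_row` (**ROW-T**, champion-free): for any vertices `o, b, q`,
  `μ(o ↔ b, b light, q heavy) · μ(b heavy, q light) ≤ μ(o ↔ b, b heavy, q light) · μ(b light, q heavy)`,
  i.e. `P(o ↔ b | b light, q heavy) ≤ P(o ↔ b | b heavy, q light)`.  This is VERBATIM an instance of the
  two-cluster exchange inequality of van den Berg–Häggström–Kahn (2006, Thm. 1.5; the tree's
  `setTwoClusterExchange` with `S = {b}`, `T = {q}`): `{o ↔ b}`, `{b heavy}`, `{q light}` are of type `(+)`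
  (closed under enlarging `C_b` and shrinking `C_q`), `{b light}`, `{q heavy}` of type `(−)`, and one light / one
  heavy forces `b ↮ q`.  (The cell-by-cell versions — monotonicity of `P(o ↔ b | M_b = s, M_q = t)` in `s` or
  in `t`, or the swap `(s,t) ↦ (t,s)` — are all FALSE numerically; only the cumulative row holds.)
* `observer_attached_champion` (**T_b**): if `q` is a level-`j` champion (`μ(M_a ≤ j) ≤ μ(M_q ≤ j)` for all
  `a ∈ A`) and `b ∈ A`, then `μ(o ↔ b, M_b ≤ j) ≤ μ(o ↔ b, M_q ≤ j)`: given that the observer hangs on the relay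
  `b`, `b` is less likely to be light than the champion.  This is the attached-champion inequality XZ
  (`stub_attachedChampion`: `μ(o ↔ A, N ≤ j) ≤ μ(o ↔ A, M_q ≤ j)`) with the attachment event `{o ↔ A}` replaced by
  `{o ↔ b}`; numerically the whole family `{o ↔ S}`, `S ⊆ A`, holds (0 / 27 000), XZ being `S = A`.
* `observer_attached_sub_le` (pair form, no champion): `μ(o ↔ b, M_b ≤ j) − μ(o ↔ b, M_q ≤ j) ≤ (μ(M_b ≤ j) − μ(M_q ≤ j))⁺`.
* `weighted_attachedChampion`: summing T_b over `b ∈ A`,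
  `∑_b μ(o ↔ b, M_b ≤ j) ≤ ∑_b μ(o ↔ b, M_q ≤ j)`, i.e. `E[N; N ≤ j] ≤ E[N; M_q ≤ j]` (`N = M_o`; on `{o ↔ b}`,
  `M_b = N`) — XZ with the weight `N`.  (For the crux this weight costs a factor `E N` and is not enough by
  itself; the unweighted XZ remains the registered residual.)
-/

noncomputable section

namespace Summit.CriticalPhenomena.PercolationContinuityZ3.Theorems

open MeasureTheory Set Literature.Probability.LatticeModels Literature.Probability.Percolation
open scoped Classical BigOperators

variable {n : ℕ}

namespace AttachedChampionObserverExchange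

/-- Monotonicity of the relay count under pointwise implication of the connection events. -/
theorem card_filter_mono (A : Finset (Fin n)) {P Q : Fin n → Prop} (h : ∀ x ∈ A, P x → Q x) :
    (A.filter P).card ≤ (A.filter Q).card := by
  apply Finset.card_le_card
  intro x hx
  simp only [Finset.mem_filter] at hx ⊢
  exact ⟨hx.1, h x hx.1 hx.2⟩

/-- One light and one heavy relay are not connected: if `b ↔ q` then `M_b = M_q`. -/
theorem card_eq_of_reachable (A : Finset (Fin n)) {b q : Fin n} {ω : BondConfig (Fin n)}
    (h : (openGraph ω).Reachable b q) :
    (A.filter fun x => ω ∈ openConn b x).card = (A.filter fun x => ω ∈ openConn q x).card := by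
  apply le_antisymm
  · refine card_filter_mono A fun x _ hx => ?_
    change (openGraph ω).Reachable q x
    exact h.symm.trans hx
  · refine card_filter_mono A fun x _ hx => ?_
    change (openGraph ω).Reachable b x
    exact h.trans hx

/-- The separation event `{b ↮ q}` in the form used by `setTwoClusterExchange` with `S = {b}`, `T = {q}`. -/
theorem mem_sep_iff {b q : Fin n} {ω : BondConfig (Fin n)} :
    ω ∈ {ω : BondConfig (Fin n) | ∀ s ∈ ({b} : Set (Fin n)), ∀ t ∈ ({q} : Set (Fin n)),
        ¬ (openGraph ω).Reachable s t} ↔ ¬ (openGraph ω).Reachable b q := by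
  simp only [mem_setOf_eq, mem_singleton_iff, forall_eq]

/-- `{M_b ≤ j < M_q} ⊆ {b ↮ q}` (intersection with the separation event is the event itself). -/
theorem sep_inter_eq_of_subset (A : Finset (Fin n)) (b q : Fin n) {E : Set (BondConfig (Fin n))}
    (hE : ∀ ω ∈ E, (A.filter fun x => ω ∈ openConn b x).card ≠ (A.filter fun x => ω ∈ openConn q x).card) :
    {ω : BondConfig (Fin n) | ∀ s ∈ ({b} : Set (Fin n)), ∀ t ∈ ({q} : Set (Fin n)),
        ¬ (openGraph ω).Reachable s t} ∩ E = E := by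
  ext ω
  refine ⟨fun h => h.2, fun h => ⟨mem_sep_iff.2 fun hr => hE ω h (card_eq_of_reachable A hr), h⟩⟩

/-- **ROW-T, raw form** (an instance of BHK 2006 Thm. 1.5 = `setTwoClusterExchange`, `S = {b}`, `T = {q}`):
with `D = {b ↮ q}`, `E = {b ↔ o}`, `X = {M_b ≤ j < M_q}`, `Y = {M_q ≤ j < M_b}`:
`μ(D ∩ (E ∩ X)) · μ(D ∩ (Y ∩ univ)) ≤ μ(D ∩ (E ∩ Y)) · μ(D ∩ (X ∩ univ))`. -/
theorem observer_row_raw (w : Sym2 (Fin n) → unitInterval) (A : Finset (Fin n)) (o b q : Fin n) (j : ℕ) :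
    (prodBernoulli w).real ({ω : BondConfig (Fin n) | ∀ s ∈ ({b} : Set (Fin n)), ∀ t ∈ ({q} : Set (Fin n)),
          ¬ (openGraph ω).Reachable s t} ∩
        ((openConn b o : Set (BondConfig (Fin n))) ∩
          {ω | (A.filter fun x => ω ∈ openConn b x).card ≤ j ∧ j < (A.filter fun x => ω ∈ openConn q x).card})) *
      (prodBernoulli w).real ({ω : BondConfig (Fin n) | ∀ s ∈ ({b} : Set (Fin n)), ∀ t ∈ ({q} : Set (Fin n)),
          ¬ (openGraph ω).Reachable s t} ∩
        ({ω | j < (A.filter fun x => ω ∈ openConn b x).card ∧ (A.filter fun x => ω ∈ openConn q x).card ≤ j} ∩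
          univ)) ≤
    (prodBernoulli w).real ({ω : BondConfig (Fin n) | ∀ s ∈ ({b} : Set (Fin n)), ∀ t ∈ ({q} : Set (Fin n)),
          ¬ (openGraph ω).Reachable s t} ∩
        ((openConn b o : Set (BondConfig (Fin n))) ∩
          {ω | j < (A.filter fun x => ω ∈ openConn b x).card ∧ (A.filter fun x => ω ∈ openConn q x).card ≤ j})) *
      (prodBernoulli w).real ({ω : BondConfig (Fin n) | ∀ s ∈ ({b} : Set (Fin n)), ∀ t ∈ ({q} : Set (Fin n)),
          ¬ (openGraph ω).Reachable s t} ∩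
        ({ω | (A.filter fun x => ω ∈ openConn b x).card ≤ j ∧ j < (A.filter fun x => ω ∈ openConn q x).card} ∩
          univ)) := by
  have hb : b ∈ ({b} : Set (Fin n)) := mem_singleton b
  have hq : q ∈ ({q} : Set (Fin n)) := mem_singleton q
  refine setTwoClusterExchange w ({b} : Set (Fin n)) ({q} : Set (Fin n)) ?_ ?_ ?_ ?_
  · -- `{b ↔ o}` is of type (+)
    intro ω ω' hs ht h
    exact TwoSetExchange.typePlus_openConn_of_mem _ _ hb o hs ht h
  · -- `{M_b > j, M_q ≤ j}` is of type (+)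
    intro ω ω' hs ht h
    refine ⟨lt_of_lt_of_le h.1 (card_filter_mono A fun x _ hx => ?_),
      le_trans (card_filter_mono A fun x _ hx => ?_) h.2⟩
    · exact TwoSetExchange.typePlus_openConn_of_mem _ _ hb x hs ht hx
    · by_contra h0
      exact (TwoSetExchange.typePlus_not_openConn_of_mem ({b} : Set (Fin n)) _ hq x hs ht h0) hx
  · -- `{M_b ≤ j, M_q > j}` is of type (−)
    intro ω ω' hs ht h
    refine ⟨le_trans (card_filter_mono A fun x _ hx => ?_) h.1,
      lt_of_lt_of_le h.2 (card_filter_mono A fun x _ hx => ?_)⟩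
    · by_contra h0
      exact (TwoSetExchange.typeMinus_not_openConn_of_mem _ ({q} : Set (Fin n)) hb x hs ht h0) hx
    · exact TwoSetExchange.typeMinus_openConn_of_mem ({b} : Set (Fin n)) _ hq x hs ht hx
  · -- `univ` is of type (−)
    intro ω ω' _ _ _
    exact mem_univ _

/-- **ROW-T (observer exchange row, champion-free).**  For any vertices `o, b, q`, relays `A`, level `j`:
`μ(o ↔ b, M_b ≤ j < M_q) · μ(M_q ≤ j < M_b) ≤ μ(o ↔ b, M_q ≤ j < M_b) · μ(M_b ≤ j < M_q)`.
[derived from: VandenbergHaggstromKahn2005, Thm. 1.5 (two-cluster exchange), via `setTwoClusterExchange`] -/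
theorem observer_row (w : Sym2 (Fin n) → unitInterval) (A : Finset (Fin n)) (o b q : Fin n) (j : ℕ) :
    (prodBernoulli w).real ((openConn o b : Set (BondConfig (Fin n))) ∩
        {ω | (A.filter fun x => ω ∈ openConn b x).card ≤ j ∧ j < (A.filter fun x => ω ∈ openConn q x).card}) *
      (prodBernoulli w).real
        {ω : BondConfig (Fin n) | j < (A.filter fun x => ω ∈ openConn b x).card ∧
          (A.filter fun x => ω ∈ openConn q x).card ≤ j} ≤
    (prodBernoulli w).real ((openConn o b : Set (BondConfig (Fin n))) ∩
        {ω | j < (A.filter fun x => ω ∈ openConn b x).card ∧ (A.filter fun x => ω ∈ openConn q x).card ≤ j}) *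
      (prodBernoulli w).real
        {ω : BondConfig (Fin n) | (A.filter fun x => ω ∈ openConn b x).card ≤ j ∧
          j < (A.filter fun x => ω ∈ openConn q x).card} := by
  have key := observer_row_raw w A o b q j
  rw [KNPreFKG.openConn_symm b o, inter_univ, inter_univ] at key
  have hX : ∀ ω ∈ ((openConn o b : Set (BondConfig (Fin n))) ∩
      {ω | (A.filter fun x => ω ∈ openConn b x).card ≤ j ∧ j < (A.filter fun x => ω ∈ openConn q x).card}),
      (A.filter fun x => ω ∈ openConn b x).card ≠ (A.filter fun x => ω ∈ openConn q x).card :=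
    fun ω h heq => absurd (heq ▸ h.2.1) (not_le.2 h.2.2)
  have hY : ∀ ω ∈ {ω : BondConfig (Fin n) | j < (A.filter fun x => ω ∈ openConn b x).card ∧
      (A.filter fun x => ω ∈ openConn q x).card ≤ j},
      (A.filter fun x => ω ∈ openConn b x).card ≠ (A.filter fun x => ω ∈ openConn q x).card :=
    fun ω h heq => absurd (heq ▸ h.1) (not_lt.2 h.2)
  have hX' : ∀ ω ∈ ((openConn o b : Set (BondConfig (Fin n))) ∩
      {ω | j < (A.filter fun x => ω ∈ openConn b x).card ∧ (A.filter fun x => ω ∈ openConn q x).card ≤ j}),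
      (A.filter fun x => ω ∈ openConn b x).card ≠ (A.filter fun x => ω ∈ openConn q x).card :=
    fun ω h => hY ω h.2
  have hY' : ∀ ω ∈ {ω : BondConfig (Fin n) | (A.filter fun x => ω ∈ openConn b x).card ≤ j ∧
      j < (A.filter fun x => ω ∈ openConn q x).card},
      (A.filter fun x => ω ∈ openConn b x).card ≠ (A.filter fun x => ω ∈ openConn q x).card :=
    fun ω h heq => absurd (heq ▸ h.1) (not_le.2 h.2)
  rw [sep_inter_eq_of_subset A b q hX, sep_inter_eq_of_subset A b q hY, sep_inter_eq_of_subset A b q hX',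
    sep_inter_eq_of_subset A b q hY'] at key
  exact key

/-- Splitting a light event against another: `{M_b ≤ j} \ {M_q ≤ j} = {M_b ≤ j < M_q}`. -/
theorem light_sdiff_light_eq (A : Finset (Fin n)) (b q : Fin n) (j : ℕ) (E : Set (BondConfig (Fin n))) :
    (E ∩ {ω : BondConfig (Fin n) | (A.filter fun x => ω ∈ openConn b x).card ≤ j}) \
        {ω : BondConfig (Fin n) | (A.filter fun x => ω ∈ openConn q x).card ≤ j} =
      E ∩ {ω | (A.filter fun x => ω ∈ openConn b x).card ≤ j ∧
        j < (A.filter fun x => ω ∈ openConn q x).card} := by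
  ext ω
  simp only [mem_sdiff, mem_inter_iff, mem_setOf_eq, not_le]
  tauto

/-- Intersection of two light events, commuted. -/
theorem light_inter_light_comm (A : Finset (Fin n)) (b q : Fin n) (j : ℕ) (E : Set (BondConfig (Fin n))) :
    (E ∩ {ω : BondConfig (Fin n) | (A.filter fun x => ω ∈ openConn b x).card ≤ j}) ∩
        {ω : BondConfig (Fin n) | (A.filter fun x => ω ∈ openConn q x).card ≤ j} =
      (E ∩ {ω : BondConfig (Fin n) | (A.filter fun x => ω ∈ openConn q x).card ≤ j}) ∩
        {ω : BondConfig (Fin n) | (A.filter fun x => ω ∈ openConn b x).card ≤ j} := by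
  ext ω
  simp only [mem_inter_iff, mem_setOf_eq]
  tauto

/-- **The exchange step behind T_b**: if `μ(M_b ≤ j < M_q) ≤ μ(M_q ≤ j < M_b)` (e.g. `q` a champion), then
`μ(o ↔ b, M_b ≤ j < M_q) ≤ μ(o ↔ b, M_q ≤ j < M_b)`. -/
theorem observer_exchange_step (w : Sym2 (Fin n) → unitInterval) (A : Finset (Fin n)) (o b q : Fin n) (j : ℕ)
    (hcmp : (prodBernoulli w).real
        {ω : BondConfig (Fin n) | (A.filter fun x => ω ∈ openConn b x).card ≤ j ∧
          j < (A.filter fun x => ω ∈ openConn q x).card} ≤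
      (prodBernoulli w).real
        {ω : BondConfig (Fin n) | j < (A.filter fun x => ω ∈ openConn b x).card ∧
          (A.filter fun x => ω ∈ openConn q x).card ≤ j}) :
    (prodBernoulli w).real ((openConn o b : Set (BondConfig (Fin n))) ∩
        {ω | (A.filter fun x => ω ∈ openConn b x).card ≤ j ∧ j < (A.filter fun x => ω ∈ openConn q x).card}) ≤
      (prodBernoulli w).real ((openConn o b : Set (BondConfig (Fin n))) ∩
        {ω | j < (A.filter fun x => ω ∈ openConn b x).card ∧
          (A.filter fun x => ω ∈ openConn q x).card ≤ j}) := by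
  set μ := prodBernoulli w with hμ
  set X : Set (BondConfig (Fin n)) := {ω | (A.filter fun x => ω ∈ openConn b x).card ≤ j ∧
    j < (A.filter fun x => ω ∈ openConn q x).card} with hX
  set Y : Set (BondConfig (Fin n)) := {ω | j < (A.filter fun x => ω ∈ openConn b x).card ∧
    (A.filter fun x => ω ∈ openConn q x).card ≤ j} with hY
  have hrow : μ.real ((openConn o b : Set (BondConfig (Fin n))) ∩ X) * μ.real Y ≤
      μ.real ((openConn o b : Set (BondConfig (Fin n))) ∩ Y) * μ.real X := observer_row w A o b q j
  by_cases hY0 : μ.real Y = 0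
  · -- then `μ(X) = 0` too and the left side vanishes
    have hX0 : μ.real X ≤ 0 := hcmp.trans (le_of_eq hY0)
    have h1 : μ.real ((openConn o b : Set (BondConfig (Fin n))) ∩ X) ≤ μ.real X :=
      measureReal_mono inter_subset_right (measure_ne_top μ _)
    exact (h1.trans hX0).trans measureReal_nonneg
  · have hYpos : 0 < μ.real Y := lt_of_le_of_ne measureReal_nonneg (Ne.symm hY0)
    have h2 : μ.real ((openConn o b : Set (BondConfig (Fin n))) ∩ X) * μ.real Y ≤
        μ.real ((openConn o b : Set (BondConfig (Fin n))) ∩ Y) * μ.real Y :=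
      hrow.trans (mul_le_mul_of_nonneg_left hcmp measureReal_nonneg)
    exact le_of_mul_le_mul_right h2 hYpos

/-- A champion comparison `μ(M_b ≤ j) ≤ μ(M_q ≤ j)` in exchange form: `μ(M_b ≤ j < M_q) ≤ μ(M_q ≤ j < M_b)`. -/
theorem exchange_of_lonelier (w : Sym2 (Fin n) → unitInterval) (A : Finset (Fin n)) (b q : Fin n) (j : ℕ)
    (h : (prodBernoulli w).real {ω : BondConfig (Fin n) | (A.filter fun x => ω ∈ openConn b x).card ≤ j} ≤
      (prodBernoulli w).real {ω : BondConfig (Fin n) | (A.filter fun x => ω ∈ openConn q x).card ≤ j}) :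
    (prodBernoulli w).real
        {ω : BondConfig (Fin n) | (A.filter fun x => ω ∈ openConn b x).card ≤ j ∧
          j < (A.filter fun x => ω ∈ openConn q x).card} ≤
      (prodBernoulli w).real
        {ω : BondConfig (Fin n) | j < (A.filter fun x => ω ∈ openConn b x).card ∧
          (A.filter fun x => ω ∈ openConn q x).card ≤ j} := by
  set μ := prodBernoulli w with hμ
  set Rb : Set (BondConfig (Fin n)) := {ω | (A.filter fun x => ω ∈ openConn b x).card ≤ j} with hRb
  set Rq : Set (BondConfig (Fin n)) := {ω | (A.filter fun x => ω ∈ openConn q x).card ≤ j} with hRq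
  have hmeas : ∀ s : Set (BondConfig (Fin n)), MeasurableSet s := fun _ => MeasurableSet.of_discrete
  have hsb : μ.real (univ ∩ Rb) = μ.real ((univ ∩ Rb) ∩ Rq) + μ.real ((univ ∩ Rb) \ Rq) :=
    (measureReal_inter_add_sdiff (μ := μ) (s := univ ∩ Rb) (t := Rq) (hmeas Rq)).symm
  have hsq : μ.real (univ ∩ Rq) = μ.real ((univ ∩ Rq) ∩ Rb) + μ.real ((univ ∩ Rq) \ Rb) :=
    (measureReal_inter_add_sdiff (μ := μ) (s := univ ∩ Rq) (t := Rb) (hmeas Rb)).symm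
  rw [light_sdiff_light_eq A b q j univ, univ_inter] at hsb
  rw [light_sdiff_light_eq A q b j univ, univ_inter] at hsq
  rw [univ_inter] at hsb hsq
  have hcomm : (Rb ∩ Rq : Set (BondConfig (Fin n))) = Rq ∩ Rb := inter_comm _ _
  have hYeq : {ω : BondConfig (Fin n) | (A.filter fun x => ω ∈ openConn q x).card ≤ j ∧
      j < (A.filter fun x => ω ∈ openConn b x).card} =
      {ω | j < (A.filter fun x => ω ∈ openConn b x).card ∧ (A.filter fun x => ω ∈ openConn q x).card ≤ j} := by
    ext ω; simp only [mem_setOf_eq]; tauto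
  rw [hYeq] at hsq
  rw [hcomm] at hsb
  linarith

end AttachedChampionObserverExchange

open AttachedChampionObserverExchange in
/-- **T_b — the attached-champion inequality for a single relay.**  If `q ∈ A` is a level-`j` champion and
`b ∈ A`, then `μ(o ↔ b, M_b ≤ j) ≤ μ(o ↔ b, M_q ≤ j)`: given that the observer hangs on `b`, the relay `b` is
less likely to be light than the champion `q`.  (XZ = `stub_attachedChampion` is the same with `{o ↔ A}`.) -/
theorem observer_attached_champion (w : Sym2 (Fin n) → unitInterval) (A : Finset (Fin n)) (o b q : Fin n)
    (j : ℕ) (hb : b ∈ A)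
    (hchamp : ∀ a ∈ A,
      (prodBernoulli w).real {ω : BondConfig (Fin n) | (A.filter fun x => ω ∈ openConn a x).card ≤ j} ≤
        (prodBernoulli w).real {ω : BondConfig (Fin n) | (A.filter fun x => ω ∈ openConn q x).card ≤ j}) :
    (prodBernoulli w).real ((openConn o b : Set (BondConfig (Fin n))) ∩
        {ω | (A.filter fun x => ω ∈ openConn b x).card ≤ j}) ≤
      (prodBernoulli w).real ((openConn o b : Set (BondConfig (Fin n))) ∩
        {ω | (A.filter fun x => ω ∈ openConn q x).card ≤ j}) := by
  set μ := prodBernoulli w with hμ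
  set E : Set (BondConfig (Fin n)) := openConn o b with hE
  set Rb : Set (BondConfig (Fin n)) := {ω | (A.filter fun x => ω ∈ openConn b x).card ≤ j} with hRb
  set Rq : Set (BondConfig (Fin n)) := {ω | (A.filter fun x => ω ∈ openConn q x).card ≤ j} with hRq
  have hmeas : ∀ s : Set (BondConfig (Fin n)), MeasurableSet s := fun _ => MeasurableSet.of_discrete
  have hsb : μ.real (E ∩ Rb) = μ.real ((E ∩ Rb) ∩ Rq) + μ.real ((E ∩ Rb) \ Rq) :=
    (measureReal_inter_add_sdiff (μ := μ) (s := E ∩ Rb) (t := Rq) (hmeas Rq)).symm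
  have hsq : μ.real (E ∩ Rq) = μ.real ((E ∩ Rq) ∩ Rb) + μ.real ((E ∩ Rq) \ Rb) :=
    (measureReal_inter_add_sdiff (μ := μ) (s := E ∩ Rq) (t := Rb) (hmeas Rb)).symm
  rw [light_sdiff_light_eq A b q j E] at hsb
  rw [light_sdiff_light_eq A q b j E, ← light_inter_light_comm A b q j E] at hsq
  have hYeq : E ∩ {ω : BondConfig (Fin n) | (A.filter fun x => ω ∈ openConn q x).card ≤ j ∧
      j < (A.filter fun x => ω ∈ openConn b x).card} =
      E ∩ {ω | j < (A.filter fun x => ω ∈ openConn b x).card ∧ (A.filter fun x => ω ∈ openConn q x).card ≤ j} := by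
    ext ω; simp only [mem_inter_iff, mem_setOf_eq]; tauto
  rw [hYeq] at hsq
  have hstep := observer_exchange_step w A o b q j (exchange_of_lonelier w A b q j (hchamp b hb))
  rw [hsb, hsq]
  linarith

open AttachedChampionObserverExchange in
/-- **Pair form without a champion**: for relays `b, q` and any vertex `o`,
`μ(o ↔ b, M_b ≤ j) − μ(o ↔ b, M_q ≤ j) ≤ (μ(M_b ≤ j) − μ(M_q ≤ j))⁺`. -/
theorem observer_attached_sub_le (w : Sym2 (Fin n) → unitInterval) (A : Finset (Fin n)) (o b q : Fin n)
    (j : ℕ) :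
    (prodBernoulli w).real ((openConn o b : Set (BondConfig (Fin n))) ∩
        {ω | (A.filter fun x => ω ∈ openConn b x).card ≤ j}) -
      (prodBernoulli w).real ((openConn o b : Set (BondConfig (Fin n))) ∩
        {ω | (A.filter fun x => ω ∈ openConn q x).card ≤ j}) ≤
    max 0 ((prodBernoulli w).real {ω : BondConfig (Fin n) | (A.filter fun x => ω ∈ openConn b x).card ≤ j} -
      (prodBernoulli w).real {ω : BondConfig (Fin n) | (A.filter fun x => ω ∈ openConn q x).card ≤ j}) := by
  set μ := prodBernoulli w with hμ
  set E : Set (BondConfig (Fin n)) := openConn o b with hE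
  set Rb : Set (BondConfig (Fin n)) := {ω | (A.filter fun x => ω ∈ openConn b x).card ≤ j} with hRb
  set Rq : Set (BondConfig (Fin n)) := {ω | (A.filter fun x => ω ∈ openConn q x).card ≤ j} with hRq
  set X : Set (BondConfig (Fin n)) := {ω | (A.filter fun x => ω ∈ openConn b x).card ≤ j ∧
    j < (A.filter fun x => ω ∈ openConn q x).card} with hX
  set Y : Set (BondConfig (Fin n)) := {ω | j < (A.filter fun x => ω ∈ openConn b x).card ∧
    (A.filter fun x => ω ∈ openConn q x).card ≤ j} with hY
  have hmeas : ∀ s : Set (BondConfig (Fin n)), MeasurableSet s := fun _ => MeasurableSet.of_discrete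
  -- the four splittings
  have hsb : μ.real (E ∩ Rb) = μ.real ((E ∩ Rb) ∩ Rq) + μ.real ((E ∩ Rb) \ Rq) :=
    (measureReal_inter_add_sdiff (μ := μ) (s := E ∩ Rb) (t := Rq) (hmeas Rq)).symm
  have hsq : μ.real (E ∩ Rq) = μ.real ((E ∩ Rq) ∩ Rb) + μ.real ((E ∩ Rq) \ Rb) :=
    (measureReal_inter_add_sdiff (μ := μ) (s := E ∩ Rq) (t := Rb) (hmeas Rb)).symm
  rw [light_sdiff_light_eq A b q j E] at hsb
  rw [light_sdiff_light_eq A q b j E, ← light_inter_light_comm A b q j E] at hsq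
  have hub : μ.real (univ ∩ Rb) = μ.real ((univ ∩ Rb) ∩ Rq) + μ.real ((univ ∩ Rb) \ Rq) :=
    (measureReal_inter_add_sdiff (μ := μ) (s := univ ∩ Rb) (t := Rq) (hmeas Rq)).symm
  have huq : μ.real (univ ∩ Rq) = μ.real ((univ ∩ Rq) ∩ Rb) + μ.real ((univ ∩ Rq) \ Rb) :=
    (measureReal_inter_add_sdiff (μ := μ) (s := univ ∩ Rq) (t := Rb) (hmeas Rb)).symm
  rw [light_sdiff_light_eq A b q j univ] at hub
  rw [light_sdiff_light_eq A q b j univ, ← light_inter_light_comm A b q j univ] at huq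
  simp only [univ_inter] at hub huq
  have hYeq : ∀ F : Set (BondConfig (Fin n)), F ∩ {ω : BondConfig (Fin n) |
      (A.filter fun x => ω ∈ openConn q x).card ≤ j ∧ j < (A.filter fun x => ω ∈ openConn b x).card} = F ∩ Y := by
    intro F; ext ω; simp only [mem_inter_iff, mem_setOf_eq, hY]; tauto
  rw [hYeq E] at hsq
  have hYeq' : {ω : BondConfig (Fin n) | (A.filter fun x => ω ∈ openConn q x).card ≤ j ∧
      j < (A.filter fun x => ω ∈ openConn b x).card} = Y := by
    have := hYeq univ; simpa only [univ_inter] using this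
  rw [hYeq'] at huq
  -- row and elementary bounds
  have hrow : μ.real (E ∩ X) * μ.real Y ≤ μ.real (E ∩ Y) * μ.real X := observer_row w A o b q j
  have hEX : μ.real (E ∩ X) ≤ μ.real X := measureReal_mono inter_subset_right (measure_ne_top μ _)
  have hEY : μ.real (E ∩ Y) ≤ μ.real Y := measureReal_mono inter_subset_right (measure_ne_top μ _)
  have hEXnn : 0 ≤ μ.real (E ∩ X) := measureReal_nonneg
  have hEYnn : 0 ≤ μ.real (E ∩ Y) := measureReal_nonneg
  -- goal: μ(E∩X) - μ(E∩Y) ≤ max 0 (μ X - μ Y)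
  have hgoal : μ.real (E ∩ X) - μ.real (E ∩ Y) ≤ max 0 (μ.real X - μ.real Y) := by
    by_cases hY0 : μ.real Y = 0
    · have h1 : μ.real (E ∩ Y) = 0 := le_antisymm (hEY.trans (le_of_eq hY0)) hEYnn
      rw [h1, hY0, sub_zero, sub_zero]
      exact hEX.trans (le_max_right _ _)
    · have hYpos : 0 < μ.real Y := lt_of_le_of_ne measureReal_nonneg (Ne.symm hY0)
      by_cases hXY : μ.real X ≤ μ.real Y
      · -- then `μ(E∩X) ≤ μ(E∩Y)`
        have h2 : μ.real (E ∩ X) * μ.real Y ≤ μ.real (E ∩ Y) * μ.real Y :=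
          hrow.trans (mul_le_mul_of_nonneg_left hXY hEYnn)
        have h3 := le_of_mul_le_mul_right h2 hYpos
        exact (sub_nonpos.2 h3).trans (le_max_left _ _)
      · -- `μ(E∩X) ≤ μ(E∩Y) μ(X)/μ(Y) ≤ μ(E∩Y) + (μ X - μ Y)` since `μ(E∩Y) ≤ μ(Y)`
        have hXY' : μ.real Y ≤ μ.real X := le_of_lt (not_le.1 hXY)
        have h4 : μ.real (E ∩ X) * μ.real Y ≤ (μ.real (E ∩ Y) + (μ.real X - μ.real Y)) * μ.real Y := by
          have : μ.real (E ∩ Y) * μ.real X ≤ (μ.real (E ∩ Y) + (μ.real X - μ.real Y)) * μ.real Y := by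
            nlinarith
          exact hrow.trans this
        have h5 := le_of_mul_le_mul_right h4 hYpos
        calc μ.real (E ∩ X) - μ.real (E ∩ Y) ≤ μ.real X - μ.real Y := by linarith
          _ ≤ max 0 (μ.real X - μ.real Y) := le_max_right _ _
  rw [hsb, hsq, hub, huq]
  have : μ.real (E ∩ Rb ∩ Rq) + μ.real (E ∩ X) - (μ.real (E ∩ Rb ∩ Rq) + μ.real (E ∩ Y)) =
      μ.real (E ∩ X) - μ.real (E ∩ Y) := by ring
  rw [this]
  have : μ.real (Rb ∩ Rq) + μ.real X - (μ.real (Rb ∩ Rq) + μ.real Y) = μ.real X - μ.real Y := by ring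
  rw [this]
  exact hgoal

/-- **The `N`-weighted attached-champion inequality** (T_b summed over `b ∈ A`):
`∑_{b ∈ A} μ(o ↔ b, M_b ≤ j) ≤ ∑_{b ∈ A} μ(o ↔ b, M_q ≤ j)`, i.e. `E[N; N ≤ j] ≤ E[N; M_q ≤ j]`. -/
theorem weighted_attachedChampion (w : Sym2 (Fin n) → unitInterval) (A : Finset (Fin n)) (o q : Fin n) (j : ℕ)
    (hchamp : ∀ a ∈ A,
      (prodBernoulli w).real {ω : BondConfig (Fin n) | (A.filter fun x => ω ∈ openConn a x).card ≤ j} ≤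
        (prodBernoulli w).real {ω : BondConfig (Fin n) | (A.filter fun x => ω ∈ openConn q x).card ≤ j}) :
    ∑ b ∈ A, (prodBernoulli w).real ((openConn o b : Set (BondConfig (Fin n))) ∩
        {ω | (A.filter fun x => ω ∈ openConn b x).card ≤ j}) ≤
      ∑ b ∈ A, (prodBernoulli w).real ((openConn o b : Set (BondConfig (Fin n))) ∩
        {ω | (A.filter fun x => ω ∈ openConn q x).card ≤ j}) :=
  Finset.sum_le_sum fun b hb => observer_attached_champion w A o b q j hb hchamp

end Summit.CriticalPhenomena.PercolationContinuityZ3.Theorems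

end
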